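import Summits.Ventures.Crystal3D.StickySpheres.FccLoomisWhitney
import HarnessLib

/-!
# Three sheared charts of a Barlow stacking: every contact is a unit step

HONEST FRAMING. Part of the venture `Summits/Ventures/Crystal3D` (cells `pub-crystal3d`,
`crystal3d-full`). Lattice combinatorics of the touching Barlow stackings
`barlowStacking 1 √(2/3) σ` (any Hägg sequence `σ`, label function `L = haggLabel σ`); nothing
off-lattice.

For a site `(k, a, b)` (layer `k`, in-layer coordinates `a, b`) consider the three integer charts
`χ₁ = (k, a, b)`, `χ₂ = (k, a + L k, a + L k + b)`, `χ₃ = (k, a + b + L k, b + L k)`.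
Each is a bijection of `ℤ³` (given `k`, the label `L k` is known), and
(`barlow_chart_steps`) every contact of the stacking is a `±` UNIT STEP in at least one chart —
in-layer contacts (six offsets) in exactly two of them, cross-layer contacts (the three sites above
and the three below, whose lateral offsets depend on the letters `σ k`, `σ (k−1)`) in exactly one:
the shear `a ↦ a + L k` (resp. `b ↦ b + L k`) straightens the zigzag column of cross-layer contacts
of lateral type `(σ, 0)` (resp. `(0, σ)`) into a coordinate line.  This is the word-uniform
replacement for the two unimodular charts of the fcc lattice (`FccLoomisWhitney.lean`, where `L`
is injective and two column families fit in one chart); it feeds the uniform surface bound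
`numContacts ≤ 6N − (9/2)N^{2/3}` for clusters on ANY Barlow stacking
(`BarlowUniformSurfaceBound.lean`).

WHAT THIS IS NOT: nothing about ground states; no sharp constant.
-/

noncomputable section

namespace Summit.Ventures.Crystal3D

open Literature.Probability.LatticeModels (Site unitStep unitStep_apply)
open Literature.MathematicalPhysics.StatisticalMechanics (barlowPos IsHaggSeq haggLabel
  haggLabel_succ sixOffsets threeOffsets dist_barlowPos_eq_iff)

/-- **Every contact is a unit step in the charts** (two of the three for an in-layer contact, one
for a cross-layer contact), stated as an inequality of indicators. -/
theorem barlow_chart_steps (σ : ℤ → ℤ) (hσ : IsHaggSeq σ) (k a b k' a' b' : ℤ)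
    (hd : dist (barlowPos 1 (Real.sqrt (2 / 3)) σ k a b)
      (barlowPos 1 (Real.sqrt (2 / 3)) σ k' a' b') = 1) :
    (if k' = k then 2 else 1) ≤
      (if ∃ d : Fin 3, ∃ s : Bool, (![k', a', b'] : Site 3) = ![k, a, b] + unitStep d s
        then 1 else 0) +
      (if ∃ d : Fin 3, ∃ s : Bool,
          (![k', a' + haggLabel σ k', a' + haggLabel σ k' + b'] : Site 3) =
            ![k, a + haggLabel σ k, a + haggLabel σ k + b] + unitStep d s
        then 1 else 0) +
      (if ∃ d : Fin 3, ∃ s : Bool,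
          (![k', a' + b' + haggLabel σ k', b' + haggLabel σ k'] : Site 3) =
            ![k, a + b + haggLabel σ k, b + haggLabel σ k] + unitStep d s
        then 1 else 0) := by
  classical
  have hh : (Real.sqrt (2 / 3)) ^ 2 = 2 / 3 * (1 : ℝ) ^ 2 := by
    rw [Real.sq_sqrt (by norm_num)]; ring
  -- a pointwise description of a unit step suffices
  have step : ∀ (d : Fin 3) (s : Bool) (v w : Site 3), (∀ l, v l = w l + unitStep d s l) →
      ∃ d : Fin 3, ∃ s : Bool, v = w + unitStep d s :=
    fun d s v w h => ⟨d, s, funext fun l => by rw [Pi.add_apply]; exact h l⟩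
  set L := haggLabel σ k with hL
  set L' := haggLabel σ k' with hL'
  set v₁ : Site 3 := ![k, a, b] with hv₁
  set v₁' : Site 3 := ![k', a', b'] with hv₁'
  set v₂ : Site 3 := ![k, a + L, a + L + b] with hv₂
  set v₂' : Site 3 := ![k', a' + L', a' + L' + b'] with hv₂'
  set v₃ : Site 3 := ![k, a + b + L, b + L] with hv₃
  set v₃' : Site 3 := ![k', a' + b' + L', b' + L'] with hv₃'
  rcases (dist_barlowPos_eq_iff hσ one_pos hh _ _ _ _ _ _).1 hd with
    ⟨hk, hoff⟩ | ⟨hk, hoff⟩ | ⟨hk, hoff⟩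
  · -- in-layer contact: two charts
    have hLL : L' = L := by rw [hL', hk]
    rw [if_pos hk]
    simp only [sixOffsets, Finset.mem_insert, Finset.mem_singleton, Prod.mk.injEq] at hoff
    rcases hoff with ⟨hP, hQ⟩ | ⟨hP, hQ⟩ | ⟨hP, hQ⟩ | ⟨hP, hQ⟩ | ⟨hP, hQ⟩ | ⟨hP, hQ⟩
    · -- offset (1,0): charts 1 and 3
      have h₁ := step 1 false v₁' v₁
          (fun l => by fin_cases l <;> simp [hv₁, hv₁', unitStep_apply] <;> omega)
      have h₃ := step 1 false v₃' v₃
          (fun l => by fin_cases l <;> simp [hv₃, hv₃', unitStep_apply] <;> omega)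
      rw [if_pos h₁, if_pos h₃]
      split_ifs <;> omega
    · -- offset (-1,0): charts 1 and 3
      have h₁ := step 1 true v₁' v₁
          (fun l => by fin_cases l <;> simp [hv₁, hv₁', unitStep_apply] <;> omega)
      have h₃ := step 1 true v₃' v₃
          (fun l => by fin_cases l <;> simp [hv₃, hv₃', unitStep_apply] <;> omega)
      rw [if_pos h₁, if_pos h₃]
      split_ifs <;> omega
    · -- offset (0,1): charts 1 and 2
      have h₁ := step 2 false v₁' v₁
          (fun l => by fin_cases l <;> simp [hv₁, hv₁', unitStep_apply] <;> omega)
      have h₂ := step 2 false v₂' v₂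
          (fun l => by fin_cases l <;> simp [hv₂, hv₂', unitStep_apply] <;> omega)
      rw [if_pos h₁, if_pos h₂]
      split_ifs <;> omega
    · -- offset (0,-1): charts 1 and 2
      have h₁ := step 2 true v₁' v₁
          (fun l => by fin_cases l <;> simp [hv₁, hv₁', unitStep_apply] <;> omega)
      have h₂ := step 2 true v₂' v₂
          (fun l => by fin_cases l <;> simp [hv₂, hv₂', unitStep_apply] <;> omega)
      rw [if_pos h₁, if_pos h₂]
      split_ifs <;> omega
    · -- offset (1,-1): charts 2 and 3
      have h₂ := step 1 false v₂' v₂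
          (fun l => by fin_cases l <;> simp [hv₂, hv₂', unitStep_apply] <;> omega)
      have h₃ := step 2 true v₃' v₃
          (fun l => by fin_cases l <;> simp [hv₃, hv₃', unitStep_apply] <;> omega)
      rw [if_pos h₂, if_pos h₃]
      split_ifs <;> omega
    · -- offset (-1,1): charts 2 and 3
      have h₂ := step 1 true v₂' v₂
          (fun l => by fin_cases l <;> simp [hv₂, hv₂', unitStep_apply] <;> omega)
      have h₃ := step 2 false v₃' v₃
          (fun l => by fin_cases l <;> simp [hv₃, hv₃', unitStep_apply] <;> omega)
      rw [if_pos h₂, if_pos h₃]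
      split_ifs <;> omega
  · -- contact with the layer above: one chart
    have hLL : L' = L + σ k := by rw [hL', hk, haggLabel_succ]
    rw [if_neg (by omega)]
    rcases hσ k with hs | hs <;> rw [hs] at hLL hoff <;>
      simp only [threeOffsets, Finset.mem_insert, Finset.mem_singleton, Prod.mk.injEq,
        show ¬ (-(1 : ℤ)) = 1 by decide, if_false, if_true, neg_neg] at hoff
    · rcases hoff with ⟨hP, hQ⟩ | ⟨hP, hQ⟩ | ⟨hP, hQ⟩
      · -- offset (0,0): chart 1
        have h₁ := step 0 true v₁' v₁
          (fun l => by fin_cases l <;> simp [hv₁, hv₁', unitStep_apply] <;> omega)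
        rw [if_pos h₁]
        split_ifs <;> omega
      · -- offset (1,0): chart 2
        have h₂ := step 0 true v₂' v₂
          (fun l => by fin_cases l <;> simp [hv₂, hv₂', unitStep_apply] <;> omega)
        rw [if_pos h₂]
        split_ifs <;> omega
      · -- offset (0,1): chart 3
        have h₃ := step 0 true v₃' v₃
          (fun l => by fin_cases l <;> simp [hv₃, hv₃', unitStep_apply] <;> omega)
        rw [if_pos h₃]
        split_ifs <;> omega
    · rcases hoff with ⟨hP, hQ⟩ | ⟨hP, hQ⟩ | ⟨hP, hQ⟩
      · -- offset (0,0): chart 1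
        have h₁ := step 0 true v₁' v₁
          (fun l => by fin_cases l <;> simp [hv₁, hv₁', unitStep_apply] <;> omega)
        rw [if_pos h₁]
        split_ifs <;> omega
      · -- offset (-1,0): chart 2
        have h₂ := step 0 true v₂' v₂
          (fun l => by fin_cases l <;> simp [hv₂, hv₂', unitStep_apply] <;> omega)
        rw [if_pos h₂]
        split_ifs <;> omega
      · -- offset (0,-1): chart 3
        have h₃ := step 0 true v₃' v₃
          (fun l => by fin_cases l <;> simp [hv₃, hv₃', unitStep_apply] <;> omega)
        rw [if_pos h₃]
        split_ifs <;> omega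
  · -- contact with the layer below: one chart
    have hLL : L = L' + σ (k - 1) := by
      rw [hL, hL', hk, show k = k - 1 + 1 by ring, haggLabel_succ]; ring_nf
    rw [if_neg (by omega)]
    rcases hσ (k - 1) with hs | hs <;> rw [hs] at hLL hoff <;>
      simp only [threeOffsets, Finset.mem_insert, Finset.mem_singleton, Prod.mk.injEq,
        show ¬ (-(1 : ℤ)) = 1 by decide, if_false, if_true] at hoff
    · rcases hoff with ⟨hP, hQ⟩ | ⟨hP, hQ⟩ | ⟨hP, hQ⟩
      · -- offset (0,0): chart 1
        have h₁ := step 0 false v₁' v₁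
          (fun l => by fin_cases l <;> simp [hv₁, hv₁', unitStep_apply] <;> omega)
        rw [if_pos h₁]
        split_ifs <;> omega
      · -- offset (-1,0): chart 2
        have h₂ := step 0 false v₂' v₂
          (fun l => by fin_cases l <;> simp [hv₂, hv₂', unitStep_apply] <;> omega)
        rw [if_pos h₂]
        split_ifs <;> omega
      · -- offset (0,-1): chart 3
        have h₃ := step 0 false v₃' v₃
          (fun l => by fin_cases l <;> simp [hv₃, hv₃', unitStep_apply] <;> omega)
        rw [if_pos h₃]
        split_ifs <;> omega
    · rcases hoff with ⟨hP, hQ⟩ | ⟨hP, hQ⟩ | ⟨hP, hQ⟩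
      · -- offset (0,0): chart 1
        have h₁ := step 0 false v₁' v₁
          (fun l => by fin_cases l <;> simp [hv₁, hv₁', unitStep_apply] <;> omega)
        rw [if_pos h₁]
        split_ifs <;> omega
      · -- offset (1,0): chart 2
        have h₂ := step 0 false v₂' v₂
          (fun l => by fin_cases l <;> simp [hv₂, hv₂', unitStep_apply] <;> omega)
        rw [if_pos h₂]
        split_ifs <;> omega
      · -- offset (0,1): chart 3
        have h₃ := step 0 false v₃' v₃
          (fun l => by fin_cases l <;> simp [hv₃, hv₃', unitStep_apply] <;> omega)
        rw [if_pos h₃]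
        split_ifs <;> omega

end Summit.Ventures.Crystal3D

end
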